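import Summits.BirchSwinnertonDyer.BirchSwinnertonDyer.Theorems.KolyvaginRankRigidityAtTwoRegularValueEngineAtTwo
import Summits.BirchSwinnertonDyer.BirchSwinnertonDyer.Theorems.ErratumRoadFiveShimuraKolyvaginOrderBoundInertShiftCebotarev
import Summits.BirchSwinnertonDyer.BirchSwinnertonDyer.Theorems.Rank1ResidualJetConjActPlaceUnramified
import Summits.BirchSwinnertonDyer.BirchSwinnertonDyer.Theorems.KolyvaginRankRigidityAtTwoChebotarevTwoLevel
import Literature.NumberTheory.EllipticCurves.SelmerCorankProofs
import HarnessLib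

/-!
# Crux U1 `KolyvaginBoundedDefectAtTwo` (stmt-BirchSwinnertonDyer-28083), LINE 17 `regular_core_rigidity` v3,
# stub S1b `stub_nearCoreExistenceAtTwo` — (N5) THE VALUE ENGINE, part 3: TWO LEVELS — classes of level `2^k`,
# regular Zhang–Kolyvagin primes of index `≥ k + 1` (the margin of g13's in-situ refill law), prescribed values
# and exact local orders read at level `2^k`

Width seat `bsd-line-krr2-p2` g14 (ONE READER on S1b); `--supports stmt-BirchSwinnertonDyer-28083` (helper). THEOREMS
ONLY; nothing here proves S1b, U1, a rung or BSD. BSD is NOT proved.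

## Why
The walk of S1b lives at level `2^k` (`S = H_{𝓕(c)}(K, E[2^k])`) but every in-situ brick of the refill law
(p672833 / p674377 / p678125, `hkM : k + 1 ≤ M(ℓ)`) needs the new prime to have Kolyvagin index `≥ k + 1`. The
value engine (`RegularValueEngine.exists_regular_kolyvaginPrime_values_of_heegner`, p682314/p683348) runs at ONE
level. This file runs it at level `2^(k+1)` on the shifted classes `ι_* c_i` (`ι_* = torsionH1OfDvd`,
`E[2^k] ↪ E[2^(k+1)]`) — the device of the tree's `McCallum1991_cor_3_2_pow_shift_of_chebotarev` (ErratumRoadFive)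
— and reads everything back at level `2^k`:
* `h1Eval_torsionH1OfDvd` — `[ι_* x, ρ] = [x, ρ]` (in `E[2^k] ⊆ E[2^(k+1)]`) for `ρ ∈ Γ_{K(E[2^(k+1)])}`, so the
  phantom-tolerant hypotheses (exponents / independence / `τ`-matrix of the RESTRICTIONS to `Γ_{K(E[2^(k+1)])}`)
  are stated directly for the level-`2^k` classes — no injectivity of `ι_*` on classes is needed;
* the character `α` is doubled (`2α`): the values `2α_i P' + 2(Tm α)_i hP' = α_i P + (Tm α)_i hP` with `P = 2P'`
  a free generator of `E[2^k]`, and the exponent arithmetic is read modulo `2^k`;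
* local orders transfer by `mem_torsionLocalKer_iff_torsionH1OfDvd_mem` (Γ_{K_λ} fixes `E[2^(k+1)]` at a
  Zhang–Kolyvagin prime of index `≥ k+1`: `JET.GlobalDuality.galoisRep_toLocal_apply_eq_self`);
* regularity at level `2^(k+1)` gives the LINE 17 regularity clause at level `2^k` (`P ↦ 2P'`).

## What (PROVED; no definition, no named fact, no `sorry`)
* §1 `h1Eval_torsionH1OfDvd` (with the tree's `KolyvaginLowerBoundAtTwo.torsionFixing_le_of_dvd`);
* §2 **`exists_regular_kolyvaginPrime_values_twoLevel`** — U1's frame binders (`K : Type` imaginary quadratic, `d_K`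
  odd, Heegner for `N_E`, `ρ̄_{E,2}` and `ρ_{E,2^(k+1)}` onto, `k ≥ 1`), `c₀`, `c ≠ 1`; a family `c_i ∈ H¹(K, E[2^k])` with
  the restricted hypotheses on `Γ_{K(E[2^(k+1)])}`, a character `α` (`2^k ∣ 2^{e i} α i`) and combinations with their
  exponents mod `2^k`; THEN one regular `h`, and for every bound a Zhang–Kolyvagin prime `ℓ > b` at `2` with
  `k + 1 ≤ M(ℓ)`, regular at level `2^(k+1)` AND at level `2^k` (LINE 17's clause verbatim), with the prescribed EXACT
  local orders of the `c_i` and of the combinations in `H¹(K_λ, E[2^k])`.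
References (locators only; no cited FACT is declared): [cite: McCallumLMS1991, §3 Prop. 3.1, Cor. 3.2; §4 Lemma 4.6]
[cite: GrossLMS1991, §3 (3.1)–(3.3), §9] [cite: WZhang2014, Notations (xii)] [cite: SerreGaloisCohomology1997, I.§2.4].
Design: no definitions; `K : Type`; axioms `propext`, `Classical.choice`, `Quot.sound`.
-/

set_option linter.dupNamespace false -- tree convention: `Summit.BirchSwinnertonDyer.BirchSwinnertonDyer.Theorems`
set_option autoImplicit false

noncomputable section

namespace Summit.BirchSwinnertonDyer.BirchSwinnertonDyer.Theorems.KolyvaginAtTwo.RegularValueEngine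

open scoped Classical
open WeierstrassCurve Field Finset
open Literature.NumberTheory.EllipticCurves Literature.NumberTheory.GaloisRepresentations

universe u

/-! ### §1 `[ι_* x, ρ] = [x, ρ]` on `Γ_{K(E[n])}` -/

/-- **`[ι_* x, ρ] = [x, ρ]`** (as elements of `E[d] ⊆ E[n]`) for the change of level `ι_* = torsionH1OfDvd` (`d ∣ n`)
and `ρ ∈ Γ_{K(E[n])}`: functoriality of `H¹` on cocycles (`resH1Hom_id_oneCocycleClass`).
[cite: SerreGaloisCohomology1997, I.§2.4] -/
theorem h1Eval_torsionH1OfDvd {k' : Type u} [Field k'] (V : WeierstrassCurve k') {d n : ℤ} (h : d ∣ n)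
    (x : galH1Torsion V d) {ρ : absoluteGaloisGroup k'} (hρ : ρ ∈ torsionFixing V n) :
    h1Eval V n (torsionH1OfDvd V h x) ρ = AddSubgroup.inclusion (V.geomTorsion_le_of_dvd h) (h1Eval V d x ρ) := by
  have hρd : ρ ∈ torsionFixing V d := KolyvaginLowerBoundAtTwo.torsionFixing_le_of_dvd V h hρ
  obtain ⟨φ, rfl⟩ := oneCocycleClass_surjective _ x
  rw [torsionH1OfDvd, resH1Hom_id_oneCocycleClass, h1Eval_oneCocycleClass V n _ hρ, h1Eval_oneCocycleClass V d _ hρd,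
    contOneCocycles.push_apply]

/-! ### §2 The two-level value engine -/

section TwoLevel

open scoped Pointwise
open NumberField IsDedekindDomain Literature.NumberTheory
open Rat.HeightOneSpectrum
open Summit.BirchSwinnertonDyer.Rank1Residual.JET.GlobalDuality (galoisRep_toLocal_apply_eq_self)

variable {W : WeierstrassCurve ℚ} {K : Type} [Field K] [NumberField K]

/-- `2^k ∣ 2^(k+1)` in `ℤ` (on the casts used by `galH1Torsion`). [folklore] -/
theorem natCast_two_pow_dvd_succ (k : ℕ) : ((2 ^ k : ℕ) : ℤ) ∣ ((2 ^ (k + 1) : ℕ) : ℤ) := by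
  exact_mod_cast pow_dvd_pow 2 (Nat.le_succ k)

/-- **THE VALUE ENGINE WITH TWO LEVELS.** `E/ℚ` globally minimal, `K : Type` imaginary quadratic, `d_K` odd, Heegner
hypothesis for `N_E`, `ρ̄_{E,2}` and `ρ_{E,2^(k+1)}` onto, `k ≥ 1`, `c₀` a complex conjugation, `c ≠ 1`. DATA: classes
`c_i ∈ H¹(K, E[2^k])` with, ON `Γ_{K(E[2^(k+1)])}`: `τ`-stability through the matrix `Tm` (`hT`), exponents `e i` (`he`)
and independence (`hind`) of the restrictions; a character `α` (`2^k ∣ 2^{e i} α i`); exponents `Nb i` / `Nq j` of the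
pairs `(α i, (Tm α) i)` / `(∑ a α, ∑ a (Tm α))` modulo `2^k`. THEN: one `ρ ∈ Γ_K` with `h = c₀ · res ρ` a regular
`μ_{2^(k+1)}`-inverting involution on `E[2^(k+1)]`, and for every `b` a prime `ℓ > b` with
`Zhang2014.IsKolyvaginPrime N_E W K 2 ℓ`, `k + 1 ≤ M(ℓ)`, Frobenius `= h` on `E[2^(k+1)]` and `c₀` on `K`, the LINE 17
regularity clause AT LEVEL `2^k`, and EXACT local orders `2^{Nb i}` of `c_i` and `2^{Nq j}` of `∑ a j i • c_i` in
`H¹(K_λ, E[2^k])`. Conditional only on the tree theorem-token `Automorphic.chebotarev_artinRep`.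
[cite: McCallumLMS1991, §3 Cor. 3.2; §4 Lemma 4.6] [cite: GrossLMS1991, §3, §9] [cite: WZhang2014, Notations (xii)] -/
theorem exists_regular_kolyvaginPrime_values_twoLevel (hCheb : Automorphic.chebotarev_artinRep)
    [W.IsElliptic] [W.IsGloballyMinimal] [NeZero (W.conductorNorm ℤ)] (hK : IsImaginaryQuadratic K)
    (hodd : Odd (NumberField.discr K)) (hH : SatisfiesHeegnerHypothesis (W.conductorNorm ℤ) K) {k : ℕ} (hk : 1 ≤ k)
    (hρ2 : W.HasSurjectiveModNGaloisRep 2) (hsurj : W.HasSurjectiveModNGaloisRep ((2 ^ (k + 1) : ℕ) : ℤ))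
    {c₀ : absoluteGaloisGroup ℚ} (hc₀ : IsComplexConjugation (Rat.castHom ℝ) c₀)
    {c : K ≃ₐ[ℚ] K} (hc : c ≠ 1)
    {r : ℕ} (cs : Fin r → galH1Torsion (W.baseChange K) ((2 ^ k : ℕ) : ℤ)) (Tm : Fin r → Fin r → ℤ)
    (hT : ∀ i, ∀ ρ ∈ torsionFixing (W.baseChange K) ((2 ^ (k + 1) : ℕ) : ℤ),
      h1Eval (W.baseChange K) ((2 ^ k : ℕ) : ℤ) (conjAct W c ((2 ^ k : ℕ) : ℤ) (cs i)) ρ =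
        h1Eval (W.baseChange K) ((2 ^ k : ℕ) : ℤ) (∑ j, Tm i j • cs j) ρ)
    (e : Fin r → ℕ)
    (he : ∀ i, ∀ ρ ∈ torsionFixing (W.baseChange K) ((2 ^ (k + 1) : ℕ) : ℤ),
      (2 : ℤ) ^ e i • h1Eval (W.baseChange K) ((2 ^ k : ℕ) : ℤ) (cs i) ρ = 0)
    (hind : ∀ a : Fin r → ℤ, (∀ ρ ∈ torsionFixing (W.baseChange K) ((2 ^ (k + 1) : ℕ) : ℤ),
      h1Eval (W.baseChange K) ((2 ^ k : ℕ) : ℤ) (∑ i, a i • cs i) ρ = 0) → ∀ i, (2 : ℤ) ^ e i ∣ a i)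
    (α : Fin r → ℤ) (hα : ∀ i, (2 : ℤ) ^ k ∣ 2 ^ e i * α i)
    (Nb : Fin r → ℕ)
    (hNb : ∀ i, (2 : ℤ) ^ k ∣ 2 ^ Nb i * α i ∧ (2 : ℤ) ^ k ∣ 2 ^ Nb i * ∑ j, Tm i j * α j ∧
      (Nb i ≠ 0 → ¬ ((2 : ℤ) ^ k ∣ 2 ^ (Nb i - 1) * α i ∧ (2 : ℤ) ^ k ∣ 2 ^ (Nb i - 1) * ∑ j, Tm i j * α j)))
    {q : ℕ} (a : Fin q → Fin r → ℤ) (Nq : Fin q → ℕ)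
    (hNq : ∀ j', (2 : ℤ) ^ k ∣ 2 ^ Nq j' * ∑ i, a j' i * α i ∧
      (2 : ℤ) ^ k ∣ 2 ^ Nq j' * ∑ i, a j' i * ∑ j, Tm i j * α j ∧
      (Nq j' ≠ 0 → ¬ ((2 : ℤ) ^ k ∣ 2 ^ (Nq j' - 1) * ∑ i, a j' i * α i ∧
        (2 : ℤ) ^ k ∣ 2 ^ (Nq j' - 1) * ∑ i, a j' i * ∑ j, Tm i j * α j))) :
    ∃ ρ : absoluteGaloisGroup K,
      (∀ X : geomTorsion W ((2 ^ (k + 1) : ℕ) : ℤ),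
        (c₀ * absGaloisRestrict ℚ K ρ) • (c₀ * absGaloisRestrict ℚ K ρ) • X = X) ∧
      (∀ ζ : AlgebraicClosure ℚ, ζ ^ (2 ^ (k + 1)) = 1 → (c₀ * absGaloisRestrict ℚ K ρ) • ζ = ζ⁻¹) ∧
      (∃ P : geomTorsion W ((2 ^ (k + 1) : ℕ) : ℤ),
        (2 : ℤ) ^ k • (P + (c₀ * absGaloisRestrict ℚ K ρ) • P) ≠ 0) ∧
      ∀ b : ℕ, ∃ ℓ : ℕ, b < ℓ ∧ Zhang2014.IsKolyvaginPrime (W.conductorNorm ℤ) W K 2 ℓ ∧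
        k + 1 ≤ Zhang2014.kolyvaginIndex W 2 ℓ ∧
        (∃ (v : HeightOneSpectrum (𝓞 ℚ)) (𝔓 : Ideal (absIntegers (𝓞 ℚ) ℚ)) (h : absoluteGaloisGroup ℚ),
          (ℓ : 𝓞 ℚ) ∈ v.asIdeal ∧ 𝔓 ∈ v.primesAbove ∧ IsArithFrobAt (𝓞 ℚ) h 𝔓 ∧
          (∀ P : geomTorsion W ((2 ^ (k + 1) : ℕ) : ℤ), h • P = (c₀ * absGaloisRestrict ℚ K ρ) • P) ∧
          (∀ (e : K →ₐ[ℚ] AlgebraicClosure ℚ) (x : K), h • e x = c₀ • e x)) ∧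
        (∃ (v : HeightOneSpectrum (𝓞 ℚ)) (𝔓 : Ideal (absIntegers (𝓞 ℚ) ℚ)) (h : absoluteGaloisGroup ℚ),
          (ℓ : 𝓞 ℚ) ∈ v.asIdeal ∧ 𝔓 ∈ v.primesAbove ∧ IsArithFrobAt (𝓞 ℚ) h 𝔓 ∧
          (∀ X : geomTorsion W ((2 ^ k : ℕ) : ℤ), h • h • X = X) ∧
          ∃ P : geomTorsion W ((2 ^ k : ℕ) : ℤ), (2 : ℤ) ^ (k - 1) • (P + h • P) ≠ 0) ∧
        (∀ i, ∀ v : HeightOneSpectrum (𝓞 K), (ℓ : 𝓞 K) ∈ v.asIdeal →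
          (((2 : ℤ) ^ Nb i) • cs i ∈
              (W.baseChange K).torsionLocalKer (v.adicCompletion K) ((2 ^ k : ℕ) : ℤ) ∧
            (Nb i ≠ 0 → ((2 : ℤ) ^ (Nb i - 1)) • cs i ∉
              (W.baseChange K).torsionLocalKer (v.adicCompletion K) ((2 ^ k : ℕ) : ℤ)))) ∧
        (∀ j', ∀ v : HeightOneSpectrum (𝓞 K), (ℓ : 𝓞 K) ∈ v.asIdeal →
          (((2 : ℤ) ^ Nq j') • (∑ i, a j' i • cs i) ∈
              (W.baseChange K).torsionLocalKer (v.adicCompletion K) ((2 ^ k : ℕ) : ℤ) ∧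
            (Nq j' ≠ 0 → ((2 : ℤ) ^ (Nq j' - 1)) • (∑ i, a j' i • cs i) ∉
              (W.baseChange K).torsionLocalKer (v.adicCompletion K) ((2 ^ k : ℕ) : ℤ)))) := by
  classical
  haveI : Fact (Nat.Prime 2) := ⟨Nat.prime_two⟩
  have hdvd := natCast_two_pow_dvd_succ k
  set ι : galH1Torsion (W.baseChange K) ((2 ^ k : ℕ) : ℤ) →+ galH1Torsion (W.baseChange K) ((2 ^ (k + 1) : ℕ) : ℤ) :=
    torsionH1OfDvd (W.baseChange K) hdvd with hιdef
  set incl : geomTorsion (W.baseChange K) ((2 ^ k : ℕ) : ℤ) →+ geomTorsion (W.baseChange K) ((2 ^ (k + 1) : ℕ) : ℤ) :=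
    AddSubgroup.inclusion ((W.baseChange K).geomTorsion_le_of_dvd hdvd) with hincl
  have hincl_inj : Function.Injective incl := AddSubgroup.inclusion_injective _
  have hιeval : ∀ (x : galH1Torsion (W.baseChange K) ((2 ^ k : ℕ) : ℤ)),
      ∀ ρ ∈ torsionFixing (W.baseChange K) ((2 ^ (k + 1) : ℕ) : ℤ),
      h1Eval (W.baseChange K) ((2 ^ (k + 1) : ℕ) : ℤ) (ι x) ρ =
        incl (h1Eval (W.baseChange K) ((2 ^ k : ℕ) : ℤ) x ρ) := fun x ρ hρ ↦
    h1Eval_torsionH1OfDvd (W.baseChange K) hdvd x hρ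
  -- ### the shifted family and its hypotheses
  set cs' : Fin r → galH1Torsion (W.baseChange K) ((2 ^ (k + 1) : ℕ) : ℤ) := fun i ↦ ι (cs i) with hcs'
  have hsumι : ∀ (w : Fin r → ℤ), ι (∑ i, w i • cs i) = ∑ i, w i • cs' i := fun w ↦ by
    rw [map_sum]; simp only [map_zsmul, hcs']
  have hT' : ∀ i, ∀ ρ ∈ torsionFixing (W.baseChange K) ((2 ^ (k + 1) : ℕ) : ℤ),
      h1Eval (W.baseChange K) ((2 ^ (k + 1) : ℕ) : ℤ) (conjAct W c ((2 ^ (k + 1) : ℕ) : ℤ) (cs' i)) ρ =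
        h1Eval (W.baseChange K) ((2 ^ (k + 1) : ℕ) : ℤ) (∑ j, Tm i j • cs' j) ρ := fun i ρ hρ ↦ by
    rw [hcs', conjAct_torsionH1OfDvd, ← hsumι, hιeval _ ρ hρ, hιeval _ ρ hρ, hT i ρ hρ]
  have he' : ∀ i, ∀ ρ ∈ torsionFixing (W.baseChange K) ((2 ^ (k + 1) : ℕ) : ℤ),
      (2 : ℤ) ^ e i • h1Eval (W.baseChange K) ((2 ^ (k + 1) : ℕ) : ℤ) (cs' i) ρ = 0 := fun i ρ hρ ↦ by
    rw [hcs', hιeval _ ρ hρ, ← map_zsmul, he i ρ hρ, map_zero]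
  have hind' : ∀ w : Fin r → ℤ, (∀ ρ ∈ torsionFixing (W.baseChange K) ((2 ^ (k + 1) : ℕ) : ℤ),
      h1Eval (W.baseChange K) ((2 ^ (k + 1) : ℕ) : ℤ) (∑ i, w i • cs' i) ρ = 0) → ∀ i, (2 : ℤ) ^ e i ∣ w i := by
    intro w hw
    refine hind w fun ρ hρ ↦ hincl_inj ?_
    rw [map_zero, ← hιeval _ ρ hρ, hsumι]
    exact hw ρ hρ
  -- ### doubled character, exponent arithmetic mod `2^(k+1)`
  set α' : Fin r → ℤ := fun i ↦ 2 * α i with hα'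
  have hTα' : ∀ i, ∑ j, Tm i j * α' j = 2 * ∑ j, Tm i j * α j := fun i ↦ by
    rw [Finset.mul_sum]; exact Finset.sum_congr rfl fun j _ ↦ by rw [hα']; ring
  have haα' : ∀ j', ∑ i, a j' i * α' i = 2 * ∑ i, a j' i * α i := fun j' ↦ by
    rw [Finset.mul_sum]; exact Finset.sum_congr rfl fun i _ ↦ by rw [hα']; ring
  have haTα' : ∀ j', ∑ i, a j' i * ∑ j, Tm i j * α' j = 2 * ∑ i, a j' i * ∑ j, Tm i j * α j := fun j' ↦ by
    rw [Finset.mul_sum]; exact Finset.sum_congr rfl fun i _ ↦ by rw [hTα']; ring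
  have hα'' : ∀ i, (2 : ℤ) ^ (k + 1) ∣ 2 ^ e i * α' i := fun i ↦ by
    rw [hα', show (2 : ℤ) ^ e i * (2 * α i) = 2 ^ e i * α i * 2 by ring, pow_succ]
    exact mul_dvd_mul_right (hα i) 2
  have hiff : ∀ (N : ℕ) (u : ℤ), (2 : ℤ) ^ (k + 1) ∣ 2 ^ N * (2 * u) ↔ (2 : ℤ) ^ k ∣ 2 ^ N * u := fun N u ↦ by
    rw [show (2 : ℤ) ^ N * (2 * u) = 2 ^ N * u * 2 by ring, pow_succ]
    exact Int.mul_dvd_mul_iff_right two_ne_zero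
  have hNb' : ∀ i, (2 : ℤ) ^ (k + 1) ∣ 2 ^ Nb i * α' i ∧ (2 : ℤ) ^ (k + 1) ∣ 2 ^ Nb i * ∑ j, Tm i j * α' j ∧
      (Nb i ≠ 0 → ¬ ((2 : ℤ) ^ (k + 1) ∣ 2 ^ (Nb i - 1) * α' i ∧
        (2 : ℤ) ^ (k + 1) ∣ 2 ^ (Nb i - 1) * ∑ j, Tm i j * α' j)) := fun i ↦ by
    obtain ⟨h1, h2, h3⟩ := hNb i
    refine ⟨by rw [hα', hiff]; exact h1, by rw [hTα', hiff]; exact h2, fun h0 h ↦ h3 h0 ?_⟩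
    rw [hα', hTα', hiff, hiff] at h
    exact h
  have hNq' : ∀ j', (2 : ℤ) ^ (k + 1) ∣ 2 ^ Nq j' * ∑ i, a j' i * α' i ∧
      (2 : ℤ) ^ (k + 1) ∣ 2 ^ Nq j' * ∑ i, a j' i * ∑ j, Tm i j * α' j ∧
      (Nq j' ≠ 0 → ¬ ((2 : ℤ) ^ (k + 1) ∣ 2 ^ (Nq j' - 1) * ∑ i, a j' i * α' i ∧
        (2 : ℤ) ^ (k + 1) ∣ 2 ^ (Nq j' - 1) * ∑ i, a j' i * ∑ j, Tm i j * α' j)) := fun j' ↦ by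
    obtain ⟨h1, h2, h3⟩ := hNq j'
    refine ⟨by rw [haα', hiff]; exact h1, by rw [haTα', hiff]; exact h2, fun h0 h ↦ h3 h0 ?_⟩
    rw [haα', haTα', hiff, hiff] at h
    exact h
  -- ### the engine at level `2^(k+1)`
  obtain ⟨ρ, hsq, hμ, hP, -, hℓ⟩ := exists_regular_kolyvaginPrime_values_of_heegner (W := W) (K := K)
    (N := W.conductorNorm ℤ) hCheb hK hodd hH k hρ2 hsurj hc₀ hc cs' Tm hT' e he' hind' α' hα'' Nb hNb' a Nq hNq'
  refine ⟨ρ, hsq, hμ, hP, fun b ↦ ?_⟩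
  obtain ⟨ℓ, hb, hZ, hidx, -, ⟨v₁, 𝔓, h, hv₁, h𝔓, hh, hhP, hhK, hinv, P', hP'⟩, hbasis, hcombo⟩ := hℓ b
  -- regularity at level `2^k`: `P := 2 P'`
  have hreg_k : (∀ X : geomTorsion W ((2 ^ k : ℕ) : ℤ), h • h • X = X) ∧
      ∃ P : geomTorsion W ((2 ^ k : ℕ) : ℤ), (2 : ℤ) ^ (k - 1) • (P + h • P) ≠ 0 := by
    have hleQ := W.geomTorsion_le_of_dvd hdvd
    refine ⟨fun X ↦ ?_, ?_⟩
    · have h1 := hinv ⟨(X : geomPoints W), hleQ X.2⟩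
      have h2 : h • h • (X : geomPoints W) = X := congrArg Subtype.val h1
      exact Subtype.ext h2
    · have h2P : (2 : ℤ) • (P' : geomPoints W) ∈ geomTorsion W ((2 ^ k : ℕ) : ℤ) := by
        rw [mem_geomTorsion_iff, smul_smul,
          show ((2 ^ k : ℕ) : ℤ) * 2 = ((2 ^ (k + 1) : ℕ) : ℤ) by push_cast; ring]
        exact (mem_geomTorsion_iff W _ _).mp P'.2
      refine ⟨⟨(2 : ℤ) • (P' : geomPoints W), h2P⟩, fun h0 ↦ hP' ?_⟩
      obtain ⟨m, hm⟩ : ∃ m, k = m + 1 := ⟨k - 1, (Nat.sub_add_cancel hk).symm⟩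
      subst hm
      rw [Nat.add_sub_cancel] at h0 ⊢
      have h1 : (2 : ℤ) ^ m • ((2 : ℤ) • (P' : geomPoints W) + h • ((2 : ℤ) • (P' : geomPoints W))) = 0 := by
        have h1' := congrArg Subtype.val h0
        simpa only [AddSubgroupClass.coe_zsmul, AddSubgroup.coe_add, AddSubgroup.torsionBy.coe_smul,
          ZeroMemClass.coe_zero] using h1'
      apply Subtype.ext
      rw [AddSubgroupClass.coe_zsmul, ZeroMemClass.coe_zero, AddSubgroup.coe_add, AddSubgroup.torsionBy.coe_smul,
        pow_succ, mul_smul, smul_add, smul_comm (2 : ℤ) h]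
      exact h1
  -- local orders back at level `2^k`
  have htriv : ∀ (w : HeightOneSpectrum (𝓞 K)), (ℓ : 𝓞 K) ∈ w.asIdeal →
      ∀ (g : absoluteGaloisGroup (w.adicCompletion K)) (Q : geomTorsion (W.baseChange K) ((2 ^ (k + 1) : ℕ) : ℤ)),
        resGal (K := K) (w.adicCompletion K) g • Q = Q := fun w hw g Q ↦ by
    rw [resGal_eq_absGaloisRestrict]
    exact galoisRep_toLocal_apply_eq_self W K hK hZ hidx w hw g Q
  have hpk : 2 ^ k ∣ 2 ^ (k + 1) := pow_dvd_pow 2 (Nat.le_succ k)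
  have hk0 : 2 ^ k ≠ 0 := pow_ne_zero _ two_ne_zero
  have hk1 : 2 ^ (k + 1) ≠ 0 := pow_ne_zero _ two_ne_zero
  have htransfer : ∀ (w : HeightOneSpectrum (𝓞 K)), (ℓ : 𝓞 K) ∈ w.asIdeal →
      ∀ (x : galH1Torsion (W.baseChange K) ((2 ^ k : ℕ) : ℤ)) (N' : ℕ),
        (((2 : ℤ) ^ N') • ι x ∈ (W.baseChange K).torsionLocalKer (w.adicCompletion K) ((2 ^ (k + 1) : ℕ) : ℤ) ∧
          (N' ≠ 0 → ((2 : ℤ) ^ (N' - 1)) • ι x ∉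
            (W.baseChange K).torsionLocalKer (w.adicCompletion K) ((2 ^ (k + 1) : ℕ) : ℤ))) →
        (((2 : ℤ) ^ N') • x ∈ (W.baseChange K).torsionLocalKer (w.adicCompletion K) ((2 ^ k : ℕ) : ℤ) ∧
          (N' ≠ 0 → ((2 : ℤ) ^ (N' - 1)) • x ∉
            (W.baseChange K).torsionLocalKer (w.adicCompletion K) ((2 ^ k : ℕ) : ℤ))) := by
    intro w hw x N' hx
    have e1 := mem_torsionLocalKer_iff_torsionH1OfDvd_mem (W.baseChange K) (w.adicCompletion K) hpk hk0 hk1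
      (htriv w hw) (((2 : ℤ) ^ N') • x)
    have e2 := mem_torsionLocalKer_iff_torsionH1OfDvd_mem (W.baseChange K) (w.adicCompletion K) hpk hk0 hk1
      (htriv w hw) (((2 : ℤ) ^ (N' - 1)) • x)
    rw [map_zsmul] at e1 e2
    exact ⟨e1.mpr hx.1, fun h0 hmem ↦ hx.2 h0 (e2.mp hmem)⟩
  refine ⟨ℓ, hb, hZ, hidx, ⟨v₁, 𝔓, h, hv₁, h𝔓, hh, hhP, hhK⟩, ⟨v₁, 𝔓, h, hv₁, h𝔓, hh, hreg_k⟩,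
    fun i w hw ↦ htransfer w hw (cs i) (Nb i) (hbasis i w hw), fun j' w hw ↦ ?_⟩
  have h1 := hcombo j' w hw
  rw [← hsumι] at h1
  exact htransfer w hw _ (Nq j') h1

end TwoLevel

end Summit.BirchSwinnertonDyer.BirchSwinnertonDyer.Theorems.KolyvaginAtTwo.RegularValueEngine

end
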